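import Summits.CriticalPhenomena.PercolationContinuityZ3.Theorems.Transplant.PlanarSkeletonFrmQuasiDefs
import Summits.CriticalPhenomena.PercolationContinuityZ3.Theorems.Transplant.SkelFrmQuasiBChoiceWindow3
import Summits.CriticalPhenomena.PercolationContinuityZ3.Theorems.Transplant.SkelFrmBChoiceWindow3
import Summits.CriticalPhenomena.PercolationContinuityZ3.Theorems.Transplant.SkelFrmQuasiBChoiceReadNums
import Summits.CriticalPhenomena.PercolationContinuityZ3.Theorems.Transplant.SkelFrmBChoiceReadNums
import Summits.CriticalPhenomena.PercolationContinuityZ3.Theorems.Transplant.SkelFrmQuasi1ChoiceDefs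
import Summits.CriticalPhenomena.PercolationContinuityZ3.Theorems.Transplant.SkelFrmQuasi1ParamsLBL
import Summits.CriticalPhenomena.PercolationContinuityZ3.Theorems.Transplant.SkelFrmQuasi1ParamsPO
import Summits.CriticalPhenomena.PercolationContinuityZ3.Theorems.Transplant.SkelFrmQuasiBChoiceNums
import Summits.CriticalPhenomena.PercolationContinuityZ3.Theorems.Transplant.SkelFrmQuasiBParamsCorrKG
import Summits.CriticalPhenomena.PercolationContinuityZ3.Theorems.Transplant.SkelFrmQuasiBParamsCorrKG0
import Summits.CriticalPhenomena.PercolationContinuityZ3.Theorems.Transplant.SkelFrmQuasiBParamsCorrKGLen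
import Summits.CriticalPhenomena.PercolationContinuityZ3.Theorems.Transplant.SkelFrmQuasiBParamsCorrKGLen3
import Summits.CriticalPhenomena.PercolationContinuityZ3.Theorems.Transplant.SkelFrmQuasiBParamsLF
import HarnessLib
import Summits.CriticalPhenomena.PercolationContinuityZ3.Theorems.Transplant.SkelFrmBChoiceReadNums3
/-!
# GEN-Q PORT (WAVE-Q table v0.8 section 2, row G096, U-level L13; captain R-6/R-7 2026-08-27: carrier token swap `PlanarSkeletonFrmFrom ↦ PlanarSkeletonFrmQuasi`)
# of the tree module «Transplant/SkelFrmFromBChoiceReadNums3» (sha256 0e39987bfd23befe…) onto the quasi-step carrier `PlanarSkeletonFrmQuasi` (p507026): «SkelFrmQuasiBChoiceReadNums3»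

ORIGINAL TITLE: N2 (frames-only node `SamePDropOfSkeletonFrm₁`, OPEN) — (ζ″) ledger under J23/(R-44): THE NUMBERS BEHIND THE (C) READING ROWS AT THE WIDER WINDOWS

builds on p205010 (kernel theorem, internal audit signed; external expert review pending) — nothing in this file uses p205010; NOTHING is claimed about any open node
((N3-b), the end state).  Lane `prim-bschramm`, seat `prim-bschramm-p3` (gen 30; design owner; tool = captain gen-1 g4's port_genq.py R-14 --cone + p3-g30 slot-value patch T1).  Helper file (`--supports stmt-CriticalPhenomena-4575 --as helper`).
PORT RULES (U-wave r1–r4 re-used, GEN-Q hunk classes of p3-g29 #6136): declaration order, names and proof texts are those of «SkelFrmFromBChoiceReadNums3», byte-identical except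
(i) the carrier token `PlanarSkeletonFrmFrom ↦ PlanarSkeletonFrmQuasi` in binders, `namespace`/`end` lines and qualified names (module names `SkelFrmFrom… ↦ SkelFrmQuasi…`
in imports of already-ported rows); (ii) `Φ.step ↦ Φ.qstep` with the called Steps lemma replaced by its `…Q`/`_q` twin and the cost `Φ.M` threaded (none in this file unless
listed below); (iii) `Φ.cyl_connected ↦ Φ.cyl_reach` readers (none unless listed); (iv) graph-ball radii / window floors ×`Φ.M` (none unless listed); (v) L-KitS-1 (design-owner ruling 2026-08-27): the (S0) kit data of «SkelFrmQuasiBChoiceNums» (stmt-g33, G017) are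
N-parametrised — IN THIS FILE the readers `KS0.R'0/r₀0/r₀0_ge/base0/reach0 ↦ …N` resp. `KS.RA' ↦ KS.RAN'`, instantiated at `N := KS.NQ Φ = 13·max Φ.M 1`, nothing else.  Carrier-free
residents stay imported/exported from the original «SkelFrmBChoiceReadNums3» exactly as in the FrmFrom port.  Docstrings and citations are the original's.

-/

open scoped Classical

noncomputable section

namespace Summit.CriticalPhenomena.PercolationContinuityZ3.Theorems.Transplant

namespace PlanarSkeletonFrmQuasi

namespace NegB

open Literature.Probability.Percolation Literature.Probability.LatticeModels SimpleGraph
open SkelConc (Consts)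
open Skelφ (shearUnit kgSL kgΔ kgN kgFar kgX kgX₂ kgM₁ kgM₂ kgWm₂ kgWp₂ kgZ₀ kgZ₁ KGRows)
open TwoAxis.Para (modulus)
open Neg

section Vals

variable (κ : Consts) {V : Type} [DecidableEq V] [Countable V] {G : SimpleGraph V} [G.LocallyFinite] (Φ : PlanarSkeletonFrmQuasi G) (t : V) (p : unitInterval)
  (D : Skelφ.StepI.DataNS V) (g f mk : ℕ)

/-- **`h0` at the wider windows** (`ρ := 0`): the first run step fits, `kgFar … 0 ≤ kgTgt0`, under `KGRes3` (`2n + qx ≤ 102n ≪ pitch ≥ 800n`). [this work] -/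
theorem kgFar_zero_le_kgTgt0_4 (κ : Consts) {V : Type} [DecidableEq V] [Countable V] {G : SimpleGraph V} [G.LocallyFinite] (Φ : PlanarSkeletonFrmQuasi G) (t : V) (p : unitInterval) (D : Skelφ.StepI.DataNS V) (g : ℕ) (f : ℕ) (mk : ℕ) (hN : EqNumL κ Φ t p D g f) (hg : gFloorKG κ Φ t p D mk ≤ g) :
    kgFar (nL κ Φ t p D g f) (ℓL κ Φ t p D g f) (hL κ Φ t p D g f) (vL κ Φ t p D g f) (kgR κ Φ t p D mk) 0 (kgq κ Φ t p D g f (qxQ4 κ Φ t p D g f))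
      (kgW κ Φ t p D g f (WxQ4 κ Φ t p D g f)) 0 ≤ kgTgt0 κ Φ t p D g f mk := by
  have hx := kgRes3_Q4 κ Φ t p D g f hN
  have H := kgRows0_of κ Φ t p D g f mk (qxQ4 κ Φ t p D g f) (WxQ4 κ Φ t p D g f) hN hg
  obtain ⟨hS, -, hS₂, -, hW2⟩ := kg_floors κ Φ t p D g f mk (WxQ4 κ Φ t p D g f) hN hg hx.hWx
  have hb := H.kgFar_zero_budget hS hS₂ hW2
  have hqx : ((qxQ4 κ Φ t p D g f : ℕ) : ℤ) ≤ 100 * (nL κ Φ t p D g f : ℤ) := by exact_mod_cast hx.hqx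
  have hv := hN.v_le
  have hK := (Skelφ.NegPrm.forty_le_Kcell κ.K₀).1
  have hK' : (40 : ℤ) ≤ (Neg.K κ : ℤ) := by unfold Neg.K; exact_mod_cast hK
  have hn0 : (0 : ℤ) ≤ nL κ Φ t p D g f := by positivity
  have hpt := (pitch_le_kgTgt0 κ Φ t p D g f mk hN).1
  have hpitch : 800 * (nL κ Φ t p D g f : ℤ) ≤ pitch κ Φ t p D g f := by unfold pitch; nlinarith
  have e1 : ((kgq κ Φ t p D g f (qxQ4 κ Φ t p D g f) : ℕ) : ℤ) = 2 * (nL κ Φ t p D g f : ℤ) + (qxQ4 κ Φ t p D g f : ℕ) := by unfold kgq; push_cast; ring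
  push_cast at hb hS₂
  linarith

/-- `kgW WxQ4 = 20·sL + 42` (as an integer) and `kgq qxQ4 = 98·n_L`. [folklore] -/
theorem kgW_WxQ4_eq (κ : Consts) {V : Type} [DecidableEq V] [Countable V] {G : SimpleGraph V} [G.LocallyFinite] (Φ : PlanarSkeletonFrmQuasi G) (t : V) (p : unitInterval) (D : Skelφ.StepI.DataNS V) (g : ℕ) (f : ℕ) (hN : EqNumL κ Φ t p D g f) :
    ((kgW κ Φ t p D g f (WxQ4 κ Φ t p D g f) : ℕ) : ℤ) = 20 * kgSL (nL κ Φ t p D g f) (ℓL κ Φ t p D g f) (hL κ Φ t p D g f) + 42 ∧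
    ((kgq κ Φ t p D g f (qxQ4 κ Φ t p D g f) : ℕ) : ℤ) = 98 * (nL κ Φ t p D g f : ℤ) := by
  have hsL := ML_sub_one_le_kgSL κ Φ t p D g f hN
  have h960 := slack_floor_le_ML κ Φ t p D g
  have hM : (959 : ℤ) ≤ ML κ Φ t p D g := by
    have : 959 ≤ ML κ Φ t p D g := by omega
    exact_mod_cast this
  have hs0 : 0 ≤ kgSL (nL κ Φ t p D g f) (ℓL κ Φ t p D g f) (hL κ Φ t p D g f) := by linarith
  constructor
  · unfold kgW WxQ4; push_cast; rw [Int.toNat_of_nonneg hs0, Int.toNat_of_nonneg (by linarith)]; ring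
  · unfold kgq qxQ4; push_cast; ring

/-- **`m₁ + 1 ≤ 62`** at `small3` (`2sL(m₁+1) ≤ 6W + 6(N+1)R′ ≤ 124sL + 255`). [this work] -/
theorem m₁Q4_le (κ : Consts) {V : Type} [DecidableEq V] [Countable V] {G : SimpleGraph V} [G.LocallyFinite] (Φ : PlanarSkeletonFrmQuasi G) (t : V) (p : unitInterval) (D : Skelφ.StepI.DataNS V) (g : ℕ) (f : ℕ) (mk : ℕ) (hN : EqNumL κ Φ t p D g f) (hg : gFloorKG κ Φ t p D mk ≤ g) (hg2 : 40 * Neg.K κ * KS0.R'0N κ Φ (KS.NQ Φ) t p D mk ≤ g) :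
    (((kgM₁ (nL κ Φ t p D g f) (ℓL κ Φ t p D g f) (hL κ Φ t p D g f) (kgR κ Φ t p D mk) 0 (kgW κ Φ t p D g f (WxQ4 κ Φ t p D g f))
      (kgNv0 κ Φ t p D g f mk (qxQ4 κ Φ t p D g f) (WxQ4 κ Φ t p D g f)) : ℕ) : ℤ)) + 1 ≤ 62 := by
  have H := kgRows0_of κ Φ t p D g f mk (qxQ4 κ Φ t p D g f) (WxQ4 κ Φ t p D g f) hN hg
  obtain ⟨hn40, hs40, hbig, hR1, hK, -⟩ := valsQ_floor κ Φ t p D g f mk hN hg hg2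
  obtain ⟨hS, -, -, -, -⟩ := kg_floors κ Φ t p D g f mk (WxQ4 κ Φ t p D g f) hN hg (kgRes3_Q4 κ Φ t p D g f hN).hWx
  have hb := H.kgM₁_budget hS (kgNv0 κ Φ t p D g f mk (qxQ4 κ Φ t p D g f) (WxQ4 κ Φ t p D g f))
  have hNle : ((kgNv0 κ Φ t p D g f mk (qxQ4 κ Φ t p D g f) (WxQ4 κ Φ t p D g f) : ℕ) : ℤ) ≤ 20 * (Neg.K κ : ℤ) + 4 := by
    exact_mod_cast kgNv0_le κ Φ t p D g f mk (qxQ4 κ Φ t p D g f) (WxQ4 κ Φ t p D g f) hN hg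
  obtain ⟨hW, -⟩ := kgW_WxQ4_eq κ Φ t p D g f hN
  unfold Skelφ.kgT₁ at hb
  rw [hW] at hb
  unfold kgR at hb ⊢
  set a := (((kgM₁ (nL κ Φ t p D g f) (ℓL κ Φ t p D g f) (hL κ Φ t p D g f) (KS0.R'0N κ Φ (KS.NQ Φ) t p D mk) 0 (kgW κ Φ t p D g f (WxQ4 κ Φ t p D g f))
      (kgNv0 κ Φ t p D g f mk (qxQ4 κ Φ t p D g f) (WxQ4 κ Φ t p D g f)) : ℕ) : ℤ)) + 1 with ha
  set s := kgSL (nL κ Φ t p D g f) (ℓL κ Φ t p D g f) (hL κ Φ t p D g f) with hs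
  set R := ((KS0.R'0N κ Φ (KS.NQ Φ) t p D mk : ℕ) : ℤ) with hRdef
  set Nn := ((kgNv0 κ Φ t p D g f mk (qxQ4 κ Φ t p D g f) (WxQ4 κ Φ t p D g f) : ℕ) : ℤ) with hNn
  -- 2 s a ≤ 120 s + 252 + 6 (N+1) R and 6(N+1)R ≤ 4 s + 3
  have h1 : 6 * ((Nn + 1) * R) ≤ 4 * s + 3 := by
    have : (Nn + 1) * R ≤ (20 * (Neg.K κ : ℤ) + 5) * R := mul_le_mul_of_nonneg_right (by linarith) (by linarith)
    nlinarith
  have h2 : 2 * s * a ≤ 124 * s + 255 := by nlinarith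
  have h3 : 2 * s * a < 2 * s * 63 := by linarith
  have := lt_of_mul_lt_mul_left h3 (by linarith)
  linarith

/-- **`X₂ ≤ 161·n_L`** at `small3` (`98n + (20K+5)R′ + 62(R′ + n)`). [this work] -/
theorem X₂Q4_le (κ : Consts) {V : Type} [DecidableEq V] [Countable V] {G : SimpleGraph V} [G.LocallyFinite] (Φ : PlanarSkeletonFrmQuasi G) (t : V) (p : unitInterval) (D : Skelφ.StepI.DataNS V) (g : ℕ) (f : ℕ) (mk : ℕ) (hN : EqNumL κ Φ t p D g f) (hg : gFloorKG κ Φ t p D mk ≤ g) (hg2 : 40 * Neg.K κ * KS0.R'0N κ Φ (KS.NQ Φ) t p D mk ≤ g) :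
    kgX₂ (nL κ Φ t p D g f) (ℓL κ Φ t p D g f) (hL κ Φ t p D g f) (vL κ Φ t p D g f) (kgR κ Φ t p D mk) 0 (kgq κ Φ t p D g f (qxQ4 κ Φ t p D g f))
      (kgW κ Φ t p D g f (WxQ4 κ Φ t p D g f)) (kgNv0 κ Φ t p D g f mk (qxQ4 κ Φ t p D g f) (WxQ4 κ Φ t p D g f)) ≤ 161 * (nL κ Φ t p D g f : ℤ) := by
  have ha := m₁Q4_le κ Φ t p D g f mk hN hg hg2
  obtain ⟨hn40, -, -, hR1, hK, h8⟩ := valsQ_floor κ Φ t p D g f mk hN hg hg2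
  have hNle : ((kgNv0 κ Φ t p D g f mk (qxQ4 κ Φ t p D g f) (WxQ4 κ Φ t p D g f) : ℕ) : ℤ) ≤ 20 * (Neg.K κ : ℤ) + 4 := by
    exact_mod_cast kgNv0_le κ Φ t p D g f mk (qxQ4 κ Φ t p D g f) (WxQ4 κ Φ t p D g f) hN hg
  obtain ⟨-, hq⟩ := kgW_WxQ4_eq κ Φ t p D g f hN
  have hv := hN.v_le
  have hva : (0 : ℤ) ≤ |vL κ Φ t p D g f| := abs_nonneg _
  unfold Skelφ.kgX₂
  rw [hq]
  unfold kgR at ha ⊢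
  set a := (((kgM₁ (nL κ Φ t p D g f) (ℓL κ Φ t p D g f) (hL κ Φ t p D g f) (KS0.R'0N κ Φ (KS.NQ Φ) t p D mk) 0 (kgW κ Φ t p D g f (WxQ4 κ Φ t p D g f))
      (kgNv0 κ Φ t p D g f mk (qxQ4 κ Φ t p D g f) (WxQ4 κ Φ t p D g f)) : ℕ) : ℤ)) + 1 with hadef
  set R := ((KS0.R'0N κ Φ (KS.NQ Φ) t p D mk : ℕ) : ℤ) with hRdef
  set Nn := ((kgNv0 κ Φ t p D g f mk (qxQ4 κ Φ t p D g f) (WxQ4 κ Φ t p D g f) : ℕ) : ℤ) with hNn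
  set n := (nL κ Φ t p D g f : ℤ) with hndef
  have ha0 : 0 ≤ a := by positivity
  have h1 : (Nn + 1) * R ≤ (20 * (Neg.K κ : ℤ) + 5) * R := mul_le_mul_of_nonneg_right (by linarith) (by linarith)
  have h2 : a * (R + ((0 : ℕ) : ℤ) + |vL κ Φ t p D g f|) ≤ 62 * (R + n) := by
    have : R + ((0 : ℕ) : ℤ) + |vL κ Φ t p D g f| ≤ R + n := by push_cast; linarith
    calc a * (R + ((0 : ℕ) : ℤ) + |vL κ Φ t p D g f|) ≤ a * (R + n) := mul_le_mul_of_nonneg_left this ha0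
      _ ≤ 62 * (R + n) := mul_le_mul_of_nonneg_right ha (by linarith)
  push_cast at h2 ⊢
  nlinarith

/-- **`m₂ + 1 ≤ 484`** at `small3` (`2n(m₂+1) ≤ 6X₂ + 3 ≤ 966n + 3`). [this work] -/
theorem m₂Q4_le (κ : Consts) {V : Type} [DecidableEq V] [Countable V] {G : SimpleGraph V} [G.LocallyFinite] (Φ : PlanarSkeletonFrmQuasi G) (t : V) (p : unitInterval) (D : Skelφ.StepI.DataNS V) (g : ℕ) (f : ℕ) (mk : ℕ) (hN : EqNumL κ Φ t p D g f) (hg : gFloorKG κ Φ t p D mk ≤ g) (hg2 : 40 * Neg.K κ * KS0.R'0N κ Φ (KS.NQ Φ) t p D mk ≤ g) :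
    (((kgM₂ (nL κ Φ t p D g f) (ℓL κ Φ t p D g f) (hL κ Φ t p D g f) (vL κ Φ t p D g f) (kgR κ Φ t p D mk) 0 (kgq κ Φ t p D g f (qxQ4 κ Φ t p D g f))
      (kgW κ Φ t p D g f (WxQ4 κ Φ t p D g f)) (kgNv0 κ Φ t p D g f mk (qxQ4 κ Φ t p D g f) (WxQ4 κ Φ t p D g f)) : ℕ) : ℤ)) + 1 ≤ 484 := by
  have H := kgRows0_of κ Φ t p D g f mk (qxQ4 κ Φ t p D g f) (WxQ4 κ Φ t p D g f) hN hg
  have hX := X₂Q4_le κ Φ t p D g f mk hN hg hg2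
  obtain ⟨-, hSn, -, -, -⟩ := kg_floors κ Φ t p D g f mk (WxQ4 κ Φ t p D g f) hN hg (kgRes3_Q4 κ Φ t p D g f hN).hWx
  have hb := H.kgM₂_succ_budget hSn (kgNv0 κ Φ t p D g f mk (qxQ4 κ Φ t p D g f) (WxQ4 κ Φ t p D g f))
  obtain ⟨-, -, -, hR1, -, h8⟩ := valsQ_floor κ Φ t p D g f mk hN hg hg2
  set b := (((kgM₂ (nL κ Φ t p D g f) (ℓL κ Φ t p D g f) (hL κ Φ t p D g f) (vL κ Φ t p D g f) (kgR κ Φ t p D mk) 0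
      (kgq κ Φ t p D g f (qxQ4 κ Φ t p D g f)) (kgW κ Φ t p D g f (WxQ4 κ Φ t p D g f)) (kgNv0 κ Φ t p D g f mk (qxQ4 κ Φ t p D g f) (WxQ4 κ Φ t p D g f)) : ℕ) : ℤ)) + 1
    with hbdef
  have hn2 : (2 : ℤ) ≤ (nL κ Φ t p D g f : ℤ) := by
    obtain ⟨hn40, -, -, hR1', hK', -⟩ := valsQ_floor κ Φ t p D g f mk hN hg hg2
    nlinarith
  have h3 : 2 * (nL κ Φ t p D g f : ℤ) * b < 2 * (nL κ Φ t p D g f : ℤ) * 485 := by linarith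
  have := lt_of_mul_lt_mul_left h3 (by positivity)
  linarith

/-- **`Z₀ ≤ 324·n_L`** and **`(N+1)·n_L + Z₀ ≤ 20K·n_L + 5·n_L`** at `small3`. [this work] -/
theorem Z₀Q4_le (κ : Consts) {V : Type} [DecidableEq V] [Countable V] {G : SimpleGraph V} [G.LocallyFinite] (Φ : PlanarSkeletonFrmQuasi G) (t : V) (p : unitInterval) (D : Skelφ.StepI.DataNS V) (g : ℕ) (f : ℕ) (mk : ℕ) (hN : EqNumL κ Φ t p D g f) (hg : gFloorKG κ Φ t p D mk ≤ g) (hg2 : 40 * Neg.K κ * KS0.R'0N κ Φ (KS.NQ Φ) t p D mk ≤ g) :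
    kgZ₀ (nL κ Φ t p D g f) (vL κ Φ t p D g f) (kgR κ Φ t p D mk) 0 (kgq κ Φ t p D g f (qxQ4 κ Φ t p D g f))
        (kgNv0 κ Φ t p D g f mk (qxQ4 κ Φ t p D g f) (WxQ4 κ Φ t p D g f))
        (kgM₁ (nL κ Φ t p D g f) (ℓL κ Φ t p D g f) (hL κ Φ t p D g f) (kgR κ Φ t p D mk) 0 (kgW κ Φ t p D g f (WxQ4 κ Φ t p D g f))
          (kgNv0 κ Φ t p D g f mk (qxQ4 κ Φ t p D g f) (WxQ4 κ Φ t p D g f)))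
        (kgM₂ (nL κ Φ t p D g f) (ℓL κ Φ t p D g f) (hL κ Φ t p D g f) (vL κ Φ t p D g f) (kgR κ Φ t p D mk) 0
          (kgq κ Φ t p D g f (qxQ4 κ Φ t p D g f)) (kgW κ Φ t p D g f (WxQ4 κ Φ t p D g f)) (kgNv0 κ Φ t p D g f mk (qxQ4 κ Φ t p D g f) (WxQ4 κ Φ t p D g f)))
      ≤ 324 * (nL κ Φ t p D g f : ℤ) ∧
    ((kgNv0 κ Φ t p D g f mk (qxQ4 κ Φ t p D g f) (WxQ4 κ Φ t p D g f) : ℕ) + 1 : ℤ) * (nL κ Φ t p D g f : ℤ) +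
      kgZ₀ (nL κ Φ t p D g f) (vL κ Φ t p D g f) (kgR κ Φ t p D mk) 0 (kgq κ Φ t p D g f (qxQ4 κ Φ t p D g f))
        (kgNv0 κ Φ t p D g f mk (qxQ4 κ Φ t p D g f) (WxQ4 κ Φ t p D g f))
        (kgM₁ (nL κ Φ t p D g f) (ℓL κ Φ t p D g f) (hL κ Φ t p D g f) (kgR κ Φ t p D mk) 0 (kgW κ Φ t p D g f (WxQ4 κ Φ t p D g f))
          (kgNv0 κ Φ t p D g f mk (qxQ4 κ Φ t p D g f) (WxQ4 κ Φ t p D g f)))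
        (kgM₂ (nL κ Φ t p D g f) (ℓL κ Φ t p D g f) (hL κ Φ t p D g f) (vL κ Φ t p D g f) (kgR κ Φ t p D mk) 0
          (kgq κ Φ t p D g f (qxQ4 κ Φ t p D g f)) (kgW κ Φ t p D g f (WxQ4 κ Φ t p D g f)) (kgNv0 κ Φ t p D g f mk (qxQ4 κ Φ t p D g f) (WxQ4 κ Φ t p D g f)))
      ≤ 20 * (Neg.K κ : ℤ) * (nL κ Φ t p D g f : ℤ) + 5 * (nL κ Φ t p D g f : ℤ) := by
  have H := kgRows0_of κ Φ t p D g f mk (qxQ4 κ Φ t p D g f) (WxQ4 κ Φ t p D g f) hN hg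
  have hX₂ := X₂Q4_le κ Φ t p D g f mk hN hg hg2
  obtain ⟨hn40, -, -, hR1, hK, h8⟩ := valsQ_floor κ Φ t p D g f mk hN hg hg2
  obtain ⟨-, -, hS₂, -, -⟩ := kg_floors κ Φ t p D g f mk (WxQ4 κ Φ t p D g f) hN hg (kgRes3_Q4 κ Φ t p D g f hN).hWx
  have hX := H.kgX_budget hS₂ (kgNv0 κ Φ t p D g f mk (qxQ4 κ Φ t p D g f) (WxQ4 κ Φ t p D g f))
  rw [Skelφ.kgZ₀_eq]
  -- the far edge: kgFar N ≤ tgt0 ≤ 20Kn + 2n + 4R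
  have hfar := (H.kgN_spec (kgFar_zero_le_kgTgt0_4 κ Φ t p D g f mk hN hg)).1
  have hNv : kgN (nL κ Φ t p D g f) (ℓL κ Φ t p D g f) (hL κ Φ t p D g f) (vL κ Φ t p D g f) (kgR κ Φ t p D mk) 0
      (kgq κ Φ t p D g f (qxQ4 κ Φ t p D g f)) (kgW κ Φ t p D g f (WxQ4 κ Φ t p D g f)) (kgTgt0 κ Φ t p D g f mk) =
      kgNv0 κ Φ t p D g f mk (qxQ4 κ Φ t p D g f) (WxQ4 κ Φ t p D g f) := rfl
  rw [hNv] at hfar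
  have hv := hN.v_le
  have hva : (0 : ℤ) ≤ |vL κ Φ t p D g f| := abs_nonneg _
  have htgt : kgTgt0 κ Φ t p D g f mk ≤ 20 * (Neg.K κ : ℤ) * (nL κ Φ t p D g f : ℤ) + 2 * (nL κ Φ t p D g f : ℤ) + 4 * ((KS0.R'0N κ Φ (KS.NQ Φ) t p D mk : ℕ) : ℤ) := by
    unfold kgTgt0 pitch Skelφ.kgΔ kgR
    have e1 := Int.ediv_mul_le ((nL κ Φ t p D g f : ℤ) - 1) (b := 2) (by norm_num)
    have e2 := Int.ediv_mul_le ((nL κ Φ t p D g f : ℤ) + (8 * ((KS0.R'0N κ Φ (KS.NQ Φ) t p D mk : ℕ) : ℤ) + 7 * ((0 : ℕ) : ℤ) + |vL κ Φ t p D g f|)) (b := 2)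
      (by norm_num)
    push_cast at e1 e2 ⊢
    linarith
  unfold Skelφ.kgFar at hfar
  unfold kgR at hX hX₂ hfar ⊢
  push_cast at hX hfar ⊢
  constructor
  · linarith
  · linarith

/-- **`Z₁ ≤ 29·sL`** at `small3` (`7P + W + sL + (N+1)R′ + (m₁+m₂+2)R′ ≤ 7(sL+2) + 20sL + 42 + sL + (20K+5)R′ + 546R′`, `40K·R′ ≤ sL + 1`). [this work] -/
theorem Z₁Q4_le (κ : Consts) {V : Type} [DecidableEq V] [Countable V] {G : SimpleGraph V} [G.LocallyFinite] (Φ : PlanarSkeletonFrmQuasi G) (t : V) (p : unitInterval) (D : Skelφ.StepI.DataNS V) (g : ℕ) (f : ℕ) (mk : ℕ) (hN : EqNumL κ Φ t p D g f) (hg : gFloorKG κ Φ t p D mk ≤ g) (hg2 : 40 * Neg.K κ * KS0.R'0N κ Φ (KS.NQ Φ) t p D mk ≤ g) :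
    kgZ₁ (nL κ Φ t p D g f) (ℓL κ Φ t p D g f) (hL κ Φ t p D g f) (kgR κ Φ t p D mk) 0 (kgW κ Φ t p D g f (WxQ4 κ Φ t p D g f))
        (kgNv0 κ Φ t p D g f mk (qxQ4 κ Φ t p D g f) (WxQ4 κ Φ t p D g f))
        (kgM₁ (nL κ Φ t p D g f) (ℓL κ Φ t p D g f) (hL κ Φ t p D g f) (kgR κ Φ t p D mk) 0 (kgW κ Φ t p D g f (WxQ4 κ Φ t p D g f))
          (kgNv0 κ Φ t p D g f mk (qxQ4 κ Φ t p D g f) (WxQ4 κ Φ t p D g f)))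
        (kgWm₂ (nL κ Φ t p D g f) (ℓL κ Φ t p D g f) (hL κ Φ t p D g f) (kgR κ Φ t p D mk) 0 (kgW κ Φ t p D g f (WxQ4 κ Φ t p D g f))
          (kgNv0 κ Φ t p D g f mk (qxQ4 κ Φ t p D g f) (WxQ4 κ Φ t p D g f)))
        (kgWp₂ (nL κ Φ t p D g f) (ℓL κ Φ t p D g f) (hL κ Φ t p D g f) (kgR κ Φ t p D mk) 0 (kgW κ Φ t p D g f (WxQ4 κ Φ t p D g f))
          (kgNv0 κ Φ t p D g f mk (qxQ4 κ Φ t p D g f) (WxQ4 κ Φ t p D g f)))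
        (kgM₂ (nL κ Φ t p D g f) (ℓL κ Φ t p D g f) (hL κ Φ t p D g f) (vL κ Φ t p D g f) (kgR κ Φ t p D mk) 0
          (kgq κ Φ t p D g f (qxQ4 κ Φ t p D g f)) (kgW κ Φ t p D g f (WxQ4 κ Φ t p D g f)) (kgNv0 κ Φ t p D g f mk (qxQ4 κ Φ t p D g f) (WxQ4 κ Φ t p D g f)))
      ≤ 29 * kgSL (nL κ Φ t p D g f) (ℓL κ Φ t p D g f) (hL κ Φ t p D g f) := by
  have H := kgRows0_of κ Φ t p D g f mk (qxQ4 κ Φ t p D g f) (WxQ4 κ Φ t p D g f) hN hg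
  have hZ := H.kgZ₁_le (kgNv0 κ Φ t p D g f mk (qxQ4 κ Φ t p D g f) (WxQ4 κ Φ t p D g f))
  have ha := m₁Q4_le κ Φ t p D g f mk hN hg hg2
  have hb := m₂Q4_le κ Φ t p D g f mk hN hg hg2
  obtain ⟨-, hs40, hbig, hR1, hK, -⟩ := valsQ_floor κ Φ t p D g f mk hN hg hg2
  have hNle : ((kgNv0 κ Φ t p D g f mk (qxQ4 κ Φ t p D g f) (WxQ4 κ Φ t p D g f) : ℕ) : ℤ) ≤ 20 * (Neg.K κ : ℤ) + 4 := by
    exact_mod_cast kgNv0_le κ Φ t p D g f mk (qxQ4 κ Φ t p D g f) (WxQ4 κ Φ t p D g f) hN hg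
  obtain ⟨hW, -⟩ := kgW_WxQ4_eq κ Φ t p D g f hN
  have hPd := Skelφ.natDiv_le_kgSLY (one_le_of_eqNumL κ Φ t p D g f hN).1 (ℓL κ Φ t p D g f) (hL κ Φ t p D g f)
  rw [kgSLY_eq_kgSL] at hPd
  rw [hW] at hZ
  unfold kgR at hZ ha hb ⊢
  set s := kgSL (nL κ Φ t p D g f) (ℓL κ Φ t p D g f) (hL κ Φ t p D g f) with hsdef
  set R := ((KS0.R'0N κ Φ (KS.NQ Φ) t p D mk : ℕ) : ℤ) with hRdef
  set Nn := ((kgNv0 κ Φ t p D g f mk (qxQ4 κ Φ t p D g f) (WxQ4 κ Φ t p D g f) : ℕ) : ℤ) with hNn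
  set a := (((kgM₁ (nL κ Φ t p D g f) (ℓL κ Φ t p D g f) (hL κ Φ t p D g f) (KS0.R'0N κ Φ (KS.NQ Φ) t p D mk) 0 (kgW κ Φ t p D g f (WxQ4 κ Φ t p D g f))
      (kgNv0 κ Φ t p D g f mk (qxQ4 κ Φ t p D g f) (WxQ4 κ Φ t p D g f)) : ℕ) : ℤ)) + 1 with hadef
  set b := (((kgM₂ (nL κ Φ t p D g f) (ℓL κ Φ t p D g f) (hL κ Φ t p D g f) (vL κ Φ t p D g f) (KS0.R'0N κ Φ (KS.NQ Φ) t p D mk) 0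
      (kgq κ Φ t p D g f (qxQ4 κ Φ t p D g f)) (kgW κ Φ t p D g f (WxQ4 κ Φ t p D g f)) (kgNv0 κ Φ t p D g f mk (qxQ4 κ Φ t p D g f) (WxQ4 κ Φ t p D g f)) : ℕ) : ℤ)) + 1
    with hbdef
  have ha0 : 0 ≤ a := by positivity
  have hb0 : 0 ≤ b := by positivity
  -- (N+1)R ≤ (20K+5)R ≤ (s+1)/2 + 5R ; (a+b)R ≤ 546 R ; 551 R ≤ 0.3 s
  have h1 : (Nn + 1) * R ≤ (20 * (Neg.K κ : ℤ) + 5) * R := mul_le_mul_of_nonneg_right (by linarith) (by linarith)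
  have h2 : (a - 1 + (b - 1) + 2) * (R + ((0 : ℕ) : ℤ)) ≤ 546 * R := by
    push_cast
    have : (a - 1 + (b - 1) + 2) = a + b := by ring
    rw [this]; nlinarith
  push_cast at hZ hPd ⊢
  nlinarith

end Vals

end NegB

end PlanarSkeletonFrmQuasi

end Summit.CriticalPhenomena.PercolationContinuityZ3.Theorems.Transplant

end
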